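import Mathlib.Data.Finsupp.Basic
import Mathlib.Algebra.BigOperators.Finsupp.Basic
import Mathlib.Algebra.Order.BigOperators.Group.Finset
import Mathlib.Tactic.Linarith
import HarnessLib

/-!
# Gan–Takeda 2016: the Howe duality theorem (typed skeleton, with its three standard consequences proved)

W. T. Gan, S. Takeda, J. Amer. Math. Soc. 29 (2016), no. 2, 473–493 (title: see [GanTakeda2015])
[GanTakeda2015] (the bib key carries the 2015 online date), §1: for a reductive dual pair `G(W) × H(V)` over a
non-archimedean local field `F` of characteristic `≠ 2` (any residual characteristic), a fixed additive character
`ψ` and splitting data, and `π ∈ Irr(G(W))`, the big theta lift `Θ(π)` has finite length (Kudla) with maximal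
semisimple quotient `θ(π)`, and (HD) `dim Hom_{H(V)}(θ(π), θ(π')) ≤ δ_{π,π'}` is a THEOREM — Theorem 1.2: "(HD)
holds for the pair `G(W) × H(V)`" (Waldspurger 1990 for `p ≠ 2`; MVW Chap. 5 for unramified pairs).  WHAT IS REPRODUCED: the
STATEMENT (HD) as a TYPED SKELETON over the hypothesis structure `LocalThetaDatum` of BARE CARRIERS (`Irr(G(W))`,
`Irr(H(V))`, and the multiplicity function of the cosocle `θ(π)`); NOTHING IS ASSERTED.  PROVED from (HD): `θ(π)`
is multiplicity free, `θ(π)` is irreducible or zero, and `θ(π) = θ(π') ≠ 0 ⇒ π = π'` (the printed form (i)–(ii) of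
Howe's statement).  Quotations AS PRINTED read on the AMS PDF (doi:10.1090/jams/839), pp. 473–474.

NOT here: the Weil representation `ω_ψ`, `Θ(π)` itself, Kudla's finiteness, the proof; the archimedean case
(Howe 1989); quaternionic pairs (excluded in the source).

## References

* [GanTakeda2015] W. T. Gan, S. Takeda, J. Amer. Math. Soc. 29 (2016) 473–493, doi:10.1090/jams/839 — §1 (HD)
  p. 473, Theorems 1.1–1.2 p. 474.
* [Waldspurger1990] J.-L. Waldspurger (1990) — the case `p ≠ 2` (Thm 1.1 (iii) of the source).
* [MoeglinVignerasWaldspurger1987] MVW, LNM 1291, Chap. 5 — unramified pairs.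
-/

namespace Literature.RepresentationTheory.GanTakeda2016

universe u v

/-- **Carriers for the non-archimedean local theta correspondence** of one reductive dual pair `G(W) × H(V)`
over a non-archimedean local field `F` of characteristic `≠ 2` with fixed `ψ` and splitting data
[GanTakeda2015, §1, p. 473]: "for any irreducible admissible representation `π` of `G(W)`, one may consider the
maximal `π`-isotypic quotient of `ω_ψ`. This has the form `π ⊗ Θ_{W,V,ψ}(π)` for some smooth representation
`Θ_{W,V,ψ}(π)` of `H(V)` … It was shown by Kudla [K1] that `Θ(π)` has finite length (possibly zero), so we may
consider its maximal semisimple quotient `θ(π)`."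
* `IrrG`, `IrrH` — the sets `Irr(G(W))`, `Irr(H(V))` of isomorphism classes of irreducible smooth (genuine, where a
  cover intervenes) representations (parameter types);
* `cosocle π σ` — the multiplicity of `σ ∈ Irr(H(V))` in `θ(π)` (a finite direct sum of irreducibles, whence a
  finitely supported function).
TYPING: only these carriers are kept; "`σ` is a quotient of `Θ(π)`" is `cosocle π σ ≠ 0`.  A hypothesis structure:
nothing is asserted. [cite: GanTakeda2015, §1, p. 473] -/
structure LocalThetaDatum (IrrG : Type u) (IrrH : Type v) where
  /-- multiplicity of `σ` in the cosocle `θ(π)` of `Θ(π)` -/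
  cosocle : IrrG → IrrH →₀ ℕ

namespace LocalThetaDatum

variable {IrrG : Type u} {IrrH : Type v}

/-- `dim Hom_{H(V)}(θ(π), θ(π'))` for the semisimple finite-length representations `θ(π)`, `θ(π')`: by Schur's
lemma it is `Σ_σ m_σ(π) · m_σ(π')` (this dictionary is the only content of the definition). [folklore] -/
def homDim (D : LocalThetaDatum IrrG IrrH) (π π' : IrrG) : ℕ :=
  (D.cosocle π).sum fun σ k => k * D.cosocle π' σ

/-- **Howe duality — a THEOREM (Gan–Takeda 2016, Thm 1.2; Waldspurger 1990 for `p ≠ 2`).**  AS PRINTED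
[GanTakeda2015, §1, p. 473], Howe's statement for `G(W) × H(V)`: "(i) `θ(π)` is either 0 or irreducible. (ii) If
`θ(π) = θ(π') ≠ 0`, then `π = π'`.  A concise reformulation is the following: for any irreducible `π` and `π'`,
(HD) `dim Hom_{H(V)}(θ(π), θ(π')) ≤ δ_{π,π'}` := `1` if `π ≅ π'`; `0` if `π ≇ π'`"; and p. 474, Theorem 1.2: "(HD)
holds for the pair `G(W) × H(V)`" (Thm 1.1 (iii): the case `p ≠ 2`, Waldspurger).  STATUS: proved in print (the
source's Theorem 1.2) — recorded here as a typed hypothesis over bare carriers, not as an open statement.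
TYPING: the two cases of `δ_{π,π'}` are the two conjuncts. [cite: GanTakeda2015, Thm 1.2, p. 474] -/
def HoweDuality (D : LocalThetaDatum IrrG IrrH) : Prop :=
  (∀ π : IrrG, D.homDim π π ≤ 1) ∧ ∀ π π' : IrrG, π ≠ π' → D.homDim π π' = 0

/-- Unfolding of `homDim` on the diagonal: `dim End(θ(π)) = Σ_σ m_σ(π)²`. [folklore] -/
theorem homDim_self_eq (D : LocalThetaDatum IrrG IrrH) (π : IrrG) :
    D.homDim π π = (D.cosocle π).sum fun _ k => k * k := by
  unfold homDim
  exact Finsupp.sum_congr fun _ _ => rfl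

/-- A single squared multiplicity is bounded by `dim End(θ(π))`. [folklore] -/
theorem sq_le_homDim_self (D : LocalThetaDatum IrrG IrrH) (π : IrrG) (σ : IrrH) :
    D.cosocle π σ * D.cosocle π σ ≤ D.homDim π π := by
  rw [homDim_self_eq]
  by_cases hσ : σ ∈ (D.cosocle π).support
  · exact Finset.single_le_sum (f := fun τ => D.cosocle π τ * D.cosocle π τ) (fun τ _ => Nat.zero_le _) hσ
  · rw [Finsupp.notMem_support_iff.mp hσ]
    exact Nat.zero_le _

/-- **Consequence of (HD): `θ(π)` is multiplicity free** — every irreducible occurs in the cosocle of `Θ(π)` at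
most once ([GanTakeda2015, Thm 1.1 (ii)] attributes this to Li–Sun–Tian; here it is read off (HD)). [folklore] -/
theorem HoweDuality.cosocle_le_one {D : LocalThetaDatum IrrG IrrH} (h : D.HoweDuality) (π : IrrG) (σ : IrrH) :
    D.cosocle π σ ≤ 1 := by
  have h1 := (D.sq_le_homDim_self π σ).trans (h.1 π)
  by_contra hc
  rw [not_le] at hc
  have : 2 * 2 ≤ D.cosocle π σ * D.cosocle π σ := Nat.mul_le_mul hc hc
  omega

/-- **Consequence of (HD), the printed (i): `θ(π)` is irreducible or zero** — at most one `σ` occurs.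
[cite: GanTakeda2015, §1 (i), p. 473] -/
theorem HoweDuality.subsingleton_support {D : LocalThetaDatum IrrG IrrH} (h : D.HoweDuality) (π : IrrG) :
    ((D.cosocle π).support : Set IrrH).Subsingleton := by
  classical
  intro σ hσ σ' hσ'
  by_contra hne
  have hσ1 : 1 ≤ D.cosocle π σ := Nat.one_le_iff_ne_zero.mpr (Finsupp.mem_support_iff.mp hσ)
  have hσ'1 : 1 ≤ D.cosocle π σ' := Nat.one_le_iff_ne_zero.mpr (Finsupp.mem_support_iff.mp hσ')
  have hpair : ({σ, σ'} : Finset IrrH) ⊆ (D.cosocle π).support := by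
    intro τ hτ
    simp only [Finset.mem_insert, Finset.mem_singleton] at hτ
    rcases hτ with rfl | rfl
    · exact hσ
    · exact hσ'
  have hsum : ∑ τ ∈ ({σ, σ'} : Finset IrrH), D.cosocle π τ * D.cosocle π τ ≤ D.homDim π π := by
    rw [homDim_self_eq]
    exact Finset.sum_le_sum_of_subset_of_nonneg hpair fun τ _ _ => Nat.zero_le _
  rw [Finset.sum_pair hne] at hsum
  have := h.1 π
  nlinarith

/-- **Consequence of (HD), the printed (ii): `θ(π) = θ(π') ≠ 0 ⇒ π = π'`** — the correspondence is injective on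
its domain. [cite: GanTakeda2015, §1 (ii), p. 473] -/
theorem HoweDuality.injective {D : LocalThetaDatum IrrG IrrH} (h : D.HoweDuality) {π π' : IrrG}
    (hne : D.cosocle π ≠ 0) (heq : D.cosocle π = D.cosocle π') : π = π' := by
  by_contra hππ'
  have h0 := h.2 π π' hππ'
  obtain ⟨σ, hσ⟩ : ∃ σ, D.cosocle π σ ≠ 0 := by
    by_contra hall
    exact hne (Finsupp.ext fun σ => not_not.mp (not_exists.mp hall σ))
  have hσmem : σ ∈ (D.cosocle π).support := Finsupp.mem_support_iff.mpr hσ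
  have hle : D.cosocle π σ * D.cosocle π' σ ≤ D.homDim π π' :=
    Finset.single_le_sum (f := fun τ => D.cosocle π τ * D.cosocle π' τ) (fun τ _ => Nat.zero_le _) hσmem
  rw [h0, ← heq] at hle
  have h1 : 1 ≤ D.cosocle π σ := Nat.one_le_iff_ne_zero.mpr hσ
  nlinarith

end LocalThetaDatum

end Literature.RepresentationTheory.GanTakeda2016
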